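import Summits.QuantumFields.YangMills.Theorems.UnitScaleTiltMinimiserStabilityRegPrAvgCurvGrad
import Summits.QuantumFields.YangMills.Theorems.UnitScaleTiltMinimiserStabilityRegPrAvgActionDefect
import Literature.MathematicalPhysics.QuantumFieldTheory.Balaban1983to89.T3SectASteps
import HarnessLib

/-!
# Route `UnitScaleTilt`, crux K1 child «MinimiserStabilityRegPr» (stmt-QuantumFields-19200), stub `stub_smoothLift` (G-K1a-2′) — helper:
# THE ROUGH REGIME `a ≤ b` OF `SmoothLiftAt` IS DISCHARGED BY THE TREE'S FACE SECTION; the located content is the smooth regime `b < a`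

Cell `ym3-torus` (HUMAN RULING D-0037, YM ladder rung R3), seat `ym3-torus-p1` gen 8 (UV side).  The schema `T3UpperLiftSplit.SmoothLiftAt L C₁ C₂ c`
asks, for a field `U` on the finest lattice of run `K` with plaquettes `< a` and curvature gradients `≤ b` (`a, b ≤ c`), for an EXACT lift `U″`
through one (0.4) averaging with plaquettes `< C₁(a+b)`, gradients `≤ C₁(b + a²)` and `L·A(U″) ≤ A(U) + C₂(b² + ab + a³)L^{3(m+K)}`.

* §1 **`smoothLift_rough`**: if `a ≤ b` the tree's explicit section `U″ := secTo F K (K+1) U` (`T3SectASteps`, the iterated face section of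
  `BlockAveragingSectionAction` through the level identification) does it with `C₁ = 2`, `C₂ = 12L²`: it is EXACT (`descendTo_secTo`,
  `expMeanLogSU_E_one`), its plaquettes are those of `U` or trivial (`plaqSmall_secTo`), hence its curvature gradients are `≤ 2a ≤ 2(b + a²)`
  (dictionary `covDerivT_plaqFT_shift_eq(_inv)` of `UnitScaleTiltMinimiserStabilityRegPrAvgCurvGrad` §1), and `A(U″) = L·A(U)`
  (`wilsonAction4_iterSec`, d = 3) with `A(U) = ½Σ|U(∂p)−1|² ≤ 12a²L^{3(m+K)} ≤ 12·ab·L^{3(m+K)}` on SU(2).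
* §2 **`smoothLiftAt_of_smooth`**: hence `SmoothLiftAt L C₁ C₂ c` follows from the same conclusion asserted ONLY for `b < a ≤ c` (with constants
  `C₁ ≥ 2`, `C₂ ≥ 12L²`): the located gap G-K1a-2′ is exactly the SMOOTH regime, where the lift must spread each coarse curvature over the `L³`
  fine plaquettes of its block (the equality case of the Jensen/Cauchy–Schwarz step of `stub_avgActionDefect`) — the interpolating lift of
  [Balaban1985Averaging] Props 3–4 / [King1986] (A.5).
-/

noncomputable section

open scoped BigOperators Matrix.Norms.L2Operator

namespace Summit.QuantumFields.YangMills.Theorems.SmoothLift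

open Literature.MathematicalPhysics.QuantumFieldTheory.Balaban1983to89
open T4Continuum BlockAveraging AveragingRT ExpMeanLog BlockAveragingSectionAction
open B10Eq27TorusAxialLog (toUField unitsField)
open B10Eq68TorusRegularity (plaqFT covDerivT)
open T3ContinuumYM3Torus T3LevelShift T3TiltDescent T3SectASteps T3UpperLiftSplit
open T3UnitLawDensityEML (ℰp)
open T3DescentFibreTower (expMeanLogSU_E_one)
open Summit.QuantumFields.YangMills.Theorems.AvgCurvGrad (covDerivT_plaqFT_shift_eq covDerivT_plaqFT_shift_eq_inv shift_unshift' covDiff_inv_le)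
open Summit.QuantumFields.YangMills.Theorems.AvgActionDefect (one_sub_reTr_eq_half_dist1_sq_su2)

/-! ## §1 The face section is a valid lift in the rough regime `a ≤ b` -/

section Rough

variable (F : T3Family)

/-- `↑(g * h) = ↑g * ↑h`. [folklore] -/
private theorem coe_mul₂ (g h : Matrix.specialUnitaryGroup (Fin 2) ℂ) :
    ((g * h : Matrix.specialUnitaryGroup (Fin 2) ℂ) : Matrix (Fin 2) (Fin 2) ℂ) = (g : Matrix (Fin 2) (Fin 2) ℂ) * (h : Matrix (Fin 2) (Fin 2) ℂ) := rfl

/-- A one-step covariant difference `u⁻¹Xu − Y` of `SU(2)` elements is at most `|X − 1| + |Y − 1|`. [folklore] -/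
private theorem covDiff_le_dist1_add (u X Y : Matrix.specialUnitaryGroup (Fin 2) ℂ) :
    ‖((u⁻¹ * X * u : Matrix.specialUnitaryGroup (Fin 2) ℂ) : Matrix (Fin 2) (Fin 2) ℂ) - (Y : Matrix (Fin 2) (Fin 2) ℂ)‖ ≤ dist1 X + dist1 Y := by
  have hd : ∀ g : Matrix.specialUnitaryGroup (Fin 2) ℂ, dist1 g = ‖(g : Matrix (Fin 2) (Fin 2) ℂ) - 1‖ := fun _ => rfl
  have h1 : ‖((u⁻¹ * X * u : Matrix.specialUnitaryGroup (Fin 2) ℂ) : Matrix (Fin 2) (Fin 2) ℂ) - (Y : Matrix (Fin 2) (Fin 2) ℂ)‖ ≤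
      ‖((u⁻¹ * X * u : Matrix.specialUnitaryGroup (Fin 2) ℂ) : Matrix (Fin 2) (Fin 2) ℂ) - 1‖ + ‖(1 : Matrix (Fin 2) (Fin 2) ℂ) - Y‖ :=
    norm_sub_le_norm_sub_add_norm_sub _ _ _
  have h2 : ‖(1 : Matrix (Fin 2) (Fin 2) ℂ) - Y‖ = dist1 Y := by rw [norm_sub_rev, hd]
  have h3 : ‖((u⁻¹ * X * u : Matrix.specialUnitaryGroup (Fin 2) ℂ) : Matrix (Fin 2) (Fin 2) ℂ) - 1‖ = dist1 X := by
    rw [← hd, show u⁻¹ * X * u = u⁻¹ * X * u⁻¹⁻¹ by rw [inv_inv], GaugeGroup.dist1_conj]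
  linarith

/-- The action of the one-step section: `A(secTo F K (K+1) U) = L·A(U)` (d = 3). [cite: Balaban1987RG1, (0.2) p.252] -/
theorem wilsonAction4_secTo_succ {G : Type*} [GaugeGroup G] (K : ℕ) (U : GaugeField (F.P K) 0 G) :
    wilsonAction4 (secTo F K (K + 1) (Nat.le_succ K) U) = (F.L : ℝ) * wilsonAction4 U := by
  have hk : K + 1 - K ≤ (F.PP F.m (K + 1)).m + (F.PP F.m (K + 1)).K := by show K + 1 - K ≤ F.m + (K + 1); omega
  show wilsonAction4 (iterSec (P := F.PP F.m (K + 1)) (K + 1 - K) (fieldShift _ U)) = _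
  rw [wilsonAction4_iterSec (K + 1 - K) hk, wilsonAction4_fieldShift, show K + 1 - K = 1 by omega]
  show (((F.L : ℕ) : ℝ) ^ (3 - 2)) ^ 1 * wilsonAction4 U = _
  norm_num

/-- On `SU(2)` the Wilson action of a field with plaquettes `< a` (`a ≥ 0`) on the finest lattice of run `K` is `≤ 12a²·L^{3(m+K)}`
(`24L^{3(m+K)}` plaquettes, `1 − Re tr W = ½|W − 1|²`). [cite: Balaban1987RG1, (0.2)/(0.14) p.252] -/
theorem wilsonAction4_le_of_plaqSmall (K : ℕ) {a : ℝ} (ha : 0 ≤ a) {U : GaugeField (F.P K) 0 (Matrix.specialUnitaryGroup (Fin 2) ℂ)}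
    (hU : PlaqSmall a U) : wilsonAction4 U ≤ 12 * a ^ 2 * (F.L : ℝ) ^ (3 * (F.m + K)) := by
  have hcard : (Fintype.card (Plaq (F.P K) 0) : ℝ) = 24 * (F.L : ℝ) ^ (3 * (F.m + K)) := by
    rw [B10Eq41TorusHistories.card_plaq_three rfl, Site.card_site]
    show ((3 * (2 * F.L ^ (F.m + K - 0)) ^ 3 : ℕ) : ℝ) = _
    rw [show F.m + K - 0 = F.m + K by omega]
    push_cast
    ring
  unfold wilsonAction4 wilsonAction
  simp only [one_mul, one_sub_reTr_eq_half_dist1_sq_su2]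
  calc ∑ p : Plaq (F.P K) 0, 1 / 2 * dist1 (GaugeField.plaqHol U p) ^ 2 ≤ ∑ _p : Plaq (F.P K) 0, 1 / 2 * a ^ 2 :=
        Finset.sum_le_sum fun p _ => by
          have h1 := (hU p).le
          have h0 := GaugeGroup.dist1_nonneg (GaugeField.plaqHol U p)
          nlinarith
    _ = 12 * a ^ 2 * (F.L : ℝ) ^ (3 * (F.m + K)) := by rw [Finset.sum_const, Finset.card_univ, nsmul_eq_mul, hcard]; ring

/-- **THE ROUGH REGIME OF G-K1a-2′ IS A THEOREM**: for every family `F`, run `K`, and `0 ≤ a ≤ b`, every field `U` on the finest lattice of run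
`K` with plaquettes `< a` has the EXACT lift `U″ = secTo F K (K+1) U` through one (0.4) averaging (exp-mean-log, `SU(2)`) with plaquettes
`< 2(a + b)`, curvature gradients `≤ 2(b + a²)`, and `L·A(U″) ≤ A(U) + 12L²·(b² + ab + a³)·L^{3(m+K)}` — the conclusion of
`SmoothLiftAt` with `C₁ = 2`, `C₂ = 12L²` (the gradient hypothesis on `U` is not needed here). [cite: Balaban1985Variational, (11) p.279] -/
theorem smoothLift_rough (K : ℕ) {a b : ℝ} (ha : 0 ≤ a) (hab : a ≤ b)
    (U : GaugeField (F.P K) 0 (Matrix.specialUnitaryGroup (Fin 2) ℂ)) (hU : PlaqSmall a U) :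
    ∃ U'' : GaugeField (F.P (K + 1)) 0 (Matrix.specialUnitaryGroup (Fin 2) ℂ),
      descendTo F ℰp K (K + 1) (Nat.le_succ K) U'' = U ∧
      PlaqSmall (2 * (a + b)) U'' ∧
      (∀ (x : Site (F.P (K + 1)) 0) (ν κ κ' : Fin (F.P (K + 1)).d), κ ≠ κ' →
        ‖covDerivT 1 (unitsField (toUField U'')) ν (plaqFT (unitsField (toUField U'')) κ κ') x‖ ≤ 2 * (b + a ^ 2)) ∧
      (F.L : ℝ) * wilsonAction4 U'' ≤ wilsonAction4 U + 12 * (F.L : ℝ) ^ 2 * (b ^ 2 + a * b + a ^ 3) * (F.L : ℝ) ^ (3 * (F.m + K)) := by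
  have hL1 : (1 : ℝ) ≤ F.L := by exact_mod_cast F.hL.2.le
  -- the trivial case `a = 0`: the hypothesis is contradictory (a plaquette exists)
  rcases eq_or_lt_of_le ha with rfl | ha0
  · exfalso
    have h := hU ⟨(fun _ => 0), ⟨0, by show 0 < 3; norm_num⟩, ⟨1, by show 1 < 3; norm_num⟩, by show (0 : ℕ) < 1; norm_num⟩
    exact absurd h (not_lt.mpr (GaugeGroup.dist1_nonneg _))
  refine ⟨secTo F K (K + 1) (Nat.le_succ K) U, descendTo_secTo F ℰp expMeanLogSU_E_one (Nat.le_succ K) U, ?_, ?_, ?_⟩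
  · -- plaquettes: those of `U` or trivial
    intro p
    exact (plaqSmall_secTo F (Nat.le_succ K) ha0 hU p).trans_le (by linarith)
  · -- gradients: a one-step covariant difference of plaquette variables `< a` is `< 2a ≤ 2(b + a²)`
    have hsmall : PlaqSmall a (secTo F K (K + 1) (Nat.le_succ K) U) := plaqSmall_secTo F (Nat.le_succ K) ha0 hU
    intro x ν κ κ' hκ
    set W : GaugeField (F.P (K + 1)) 0 (Matrix.specialUnitaryGroup (Fin 2) ℂ) := secTo F K (K + 1) (Nat.le_succ K) U with hW
    have hbound : ∀ X Y u : Matrix.specialUnitaryGroup (Fin 2) ℂ, dist1 X < a → dist1 Y < a →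
        ‖((u⁻¹ * X * u : Matrix.specialUnitaryGroup (Fin 2) ℂ) : Matrix (Fin 2) (Fin 2) ℂ) - (Y : Matrix (Fin 2) (Fin 2) ℂ)‖ ≤ 2 * (b + a ^ 2) := by
      intro X Y u hX hY
      refine (covDiff_le_dist1_add u X Y).trans ?_
      nlinarith [sq_nonneg a]
    rcases lt_or_gt_of_ne hκ with hlt | hgt
    · rw [← shift_unshift' x ν, covDerivT_plaqFT_shift_eq W ν hlt]
      exact hbound _ _ _ (hsmall _) (hsmall _)
    · rw [← shift_unshift' x ν, covDerivT_plaqFT_shift_eq_inv W ν hgt]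
      refine (covDiff_inv_le _ _ _).trans ?_
      exact hbound _ _ _ (hsmall _) (hsmall _)
  · -- action: `L·A(U″) = L²·A(U) ≤ A(U) + 12L²·a²·L^{3(m+K)}` and `a² ≤ ab`
    rw [wilsonAction4_secTo_succ]
    have hA := wilsonAction4_le_of_plaqSmall F K ha hU
    have hA0 : 0 ≤ wilsonAction4 U := wilsonAction4_nonneg U
    have hpow : 0 ≤ (F.L : ℝ) ^ (3 * (F.m + K)) := by positivity
    have hab2 : a ^ 2 ≤ b ^ 2 + a * b + a ^ 3 := by nlinarith [mul_nonneg ha (ha.trans hab), pow_nonneg ha 3]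
    have hL2 : (F.L : ℝ) * ((F.L : ℝ) * wilsonAction4 U) ≤ wilsonAction4 U + ((F.L : ℝ) ^ 2 - 1) * wilsonAction4 U := by nlinarith
    have hkey : ((F.L : ℝ) ^ 2 - 1) * wilsonAction4 U ≤ 12 * (F.L : ℝ) ^ 2 * (b ^ 2 + a * b + a ^ 3) * (F.L : ℝ) ^ (3 * (F.m + K)) := by
      calc ((F.L : ℝ) ^ 2 - 1) * wilsonAction4 U ≤ (F.L : ℝ) ^ 2 * (12 * a ^ 2 * (F.L : ℝ) ^ (3 * (F.m + K))) :=
            mul_le_mul (by linarith) hA hA0 (by positivity)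
        _ ≤ (F.L : ℝ) ^ 2 * (12 * (b ^ 2 + a * b + a ^ 3) * (F.L : ℝ) ^ (3 * (F.m + K))) := by gcongr
        _ = _ := by ring
    linarith

end Rough

/-! ## §2 `SmoothLiftAt` reduces to the smooth regime `b < a` -/

section Reduction

/-- **G-K1a-2′ IS THE SMOOTH REGIME**: if for every family with `F.L = L`, every run `K` and every `0 ≤ b < a ≤ c` the fields with
plaquettes `< a` and curvature gradients `≤ b` admit an exact lift with plaquettes `< C₁(a+b)`, gradients `≤ C₁(b + a²)` and
`L·A(U″) ≤ A(U) + C₂(b² + ab + a³)L^{3(m+K)}`, where `2 ≤ C₁` and `12L² ≤ C₂`, then `SmoothLiftAt L C₁ C₂ c` (the rough regime `a ≤ b` being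
`smoothLift_rough`). [cite: Balaban1985Averaging, Prop. 3 (122)-(125) p.36] -/
theorem smoothLiftAt_of_smooth (L : ℕ) {C₁ C₂ c : ℝ} (hC₁ : 2 ≤ C₁) (hC₂ : 12 * (L : ℝ) ^ 2 ≤ C₂)
    (hsmooth : ∀ F : T3Family, F.L = L → ∀ (K : ℕ) (a b : ℝ), 0 ≤ b → b < a → a ≤ c →
      ∀ U : GaugeField (F.P K) 0 (Matrix.specialUnitaryGroup (Fin 2) ℂ), PlaqSmall a U →
        (∀ (x : Site (F.P K) 0) (ν κ κ' : Fin (F.P K).d), κ ≠ κ' →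
          ‖covDerivT 1 (unitsField (toUField U)) ν (plaqFT (unitsField (toUField U)) κ κ') x‖ ≤ b) →
          ∃ U'' : GaugeField (F.P (K + 1)) 0 (Matrix.specialUnitaryGroup (Fin 2) ℂ),
            descendTo F ℰp K (K + 1) (Nat.le_succ K) U'' = U ∧
            PlaqSmall (C₁ * (a + b)) U'' ∧
            (∀ (x : Site (F.P (K + 1)) 0) (ν κ κ' : Fin (F.P (K + 1)).d), κ ≠ κ' →
              ‖covDerivT 1 (unitsField (toUField U'')) ν (plaqFT (unitsField (toUField U'')) κ κ') x‖ ≤ C₁ * (b + a ^ 2)) ∧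
            (F.L : ℝ) * wilsonAction4 U'' ≤ wilsonAction4 U + C₂ * (b ^ 2 + a * b + a ^ 3) * (F.L : ℝ) ^ (3 * (F.m + K))) :
    SmoothLiftAt L C₁ C₂ c := by
  intro F hFL K a b ha hac hb _ U hU hgrad
  by_cases hab : a ≤ b
  · obtain ⟨U'', hD, hP, hG, hA⟩ := smoothLift_rough F K ha hab U hU
    subst hFL
    have hq : 0 ≤ b ^ 2 + a * b + a ^ 3 := by positivity
    have hpow : 0 ≤ (F.L : ℝ) ^ (3 * (F.m + K)) := by positivity
    refine ⟨U'', hD, fun p => (hP p).trans_le ?_, fun x ν κ κ' hκ => (hG x ν κ κ' hκ).trans ?_, hA.trans ?_⟩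
    · exact mul_le_mul_of_nonneg_right hC₁ (by linarith)
    · exact mul_le_mul_of_nonneg_right hC₁ (by positivity)
    · have := mul_le_mul_of_nonneg_right (mul_le_mul_of_nonneg_right hC₂ hq) hpow
      linarith
  · exact hsmooth F hFL K a b hb (lt_of_not_ge hab) hac U hU hgrad

end Reduction

end Summit.QuantumFields.YangMills.Theorems.SmoothLift

end
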